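import Summits.AtomisticToContinuum.HydrodynamicLimit.Theorems.TwoClocksEquilibriumFastWindowLDBirthT12Zonal
import Literature.Analysis.FluidPDE.LambertCosineLaw
import Literature.Probability.Distributions.GaussianSphereMarginal
import Mathlib.MeasureTheory.Function.JacobianOneDim
import Mathlib.MeasureTheory.Integral.IntervalIntegral.Basic
import HarnessLib

/-!
# Archimedes' hat-box law on `S²` and the angular contraction lemma (FF3)
# (helpers `t12_sphereMeasure_map_inner`, `t12_angularContraction` of the line `birth`, crux
# `TwoClocks.EquilibriumFastWindowLD`, stmt-AtomisticToContinuum-14440; infrastructure file 2 of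
# the analytic residue `t12_logLinearPreimage_and_dipoleModulus` of `stub_correctorTransfer`)

The `ℓ ≥ 2` part of the corrector analysis (plan §6 of the registered sub-goal
`t12_logLinearPreimage_and_dipoleModulus`: linear growth of the component `Π_{≥2}ψ` of the
Chapman–Enskog pre-image) runs an `L^∞`-in-angle, sup-in-radius scheme whose engine is a family of
ZONAL operators on the sphere, `(K u)(a) = ∫_{S²} k(⟪a, ω⟫) u(ω) dσ(ω)` (far-field collision steps,
circle averages and their iterates), applied to angular profiles `u` with no `ℓ = 0, 1`
components. Two facts are used over and over; this file supplies them.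

* **The hat-box law** (Archimedes): under the surface measure `σ = volume.toSphere` of
  `S² ⊂ ℝ³` (total mass `4π`) the height `⟪a, ω⟫` (`|a| = 1`) is `2π ·` Lebesgue on `[-1, 1]`:
  `σ ∘ ⟪a, ·⟫⁻¹ = 2π · Leb|_{[-1,1]}` (`t12_sphereMeasure_map_inner`, registered), hence
  `∫_{S²} g(⟪a, ω⟫) dσ(ω) = 2π ∫_{-1}^{1} g` for measurable `g ≥ 0` (`lintegral_sphere_comp_inner`)
  and for Banach-valued `g` (`integral_sphere_comp_inner(_real)`), with the integrability transfer
  `integrable_sphere_comp_inner_iff`. Proof: the flux form of the hat-box theorem of the tree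
  (`lintegral_toSphere_cos_comp_coords`, `LambertCosineLaw.lean`: under `⟪a, ν⟫₊ dσ` the
  tangential coordinates are Lebesgue on the unit disc) tested against
  `g(√(1 - |p|²))/√(1 - |p|²)`, polar coordinates in the disc (`lintegral_fun_norm_addHaar`) and
  the substitution `x = √(1 - y²)` give the open upper hemisphere; the lower one is the upper
  hemisphere of `-a`, and the equator is `σ`-null (`sphereMeasure_inner_eq_zero`).
* **FF3, the angular contraction (duality) lemma** (`t12_angularContraction`, registered): if
  `k` is integrable on `[-1, 1]`, `u : S² → ℝ` is measurable, `|u| ≤ m`, `∫ u dσ = 0` (zero zonal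
  average) and `∫ u(ω) ω dσ(ω) = 0` (zero dipole moment), then for all `A, B`,
  `|∫ k(⟪a, ω⟫) u(ω) dσ(ω)| ≤ m · 2π ∫_{-1}^{1} |k(x) - A - B x| dx`
  (subtract the affine profile `A + B⟪a, ω⟫`, which `u` annihilates). Optimising in `A, B` gives
  `m · 2π dist_{L¹[-1,1]}(k, span{1, x})`, the norm of the zonal operator on the sector `ℓ ≥ 2`
  of `L^∞(S²)`; for one far-field collision step, `k = (2/π) x₊²`, the constant is
  `4 ∫_{-1}^{1} |x₊² - 1/8 - x/4| dx = 1` (sibling file `…BirthT12Legendre`), which is why the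
  plan iterates the step. NOT here: composition of zonal kernels (FF2), the far-field
  representation with rates (FF1), the Legendre certificate (FF4).
-/noncomputable section

open MeasureTheory Real Set Filter Metric
open scoped ENNReal BigOperators InnerProductSpace Pointwise
namespace Summit.AtomisticToContinuum.HydrodynamicLimit.Theorems.ClampedCorrectorBirth

open Literature.Analysis.FluidPDE Literature.MathematicalPhysics.KineticTheory

/-! ### One-dimensional and measure-theoretic preliminaries -/

/-- The substitution `x = √(1 - y²)` on `(0, 1)`:
`∫₀¹ (y/√(1-y²)) g(√(1-y²)) dy = ∫₀¹ g(x) dx` for every `g ≥ 0`. [folklore] -/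
theorem lintegral_Ioo_comp_sqrt_one_sub_sq (g : ℝ → ℝ≥0∞) :
    ∫⁻ y in Ioo (0 : ℝ) 1, ENNReal.ofReal (y / √(1 - y ^ 2)) * g (√(1 - y ^ 2)) =
      ∫⁻ x in Ioo (0 : ℝ) 1, g x := by
  have hpos : ∀ y ∈ Ioo (0 : ℝ) 1, 0 < 1 - y ^ 2 := fun y hy => by nlinarith [hy.1, hy.2]
  have hderiv : ∀ y ∈ Ioo (0 : ℝ) 1, HasDerivWithinAt (fun y : ℝ => √(1 - y ^ 2))
      (-(2 * y) / (2 * √(1 - y ^ 2))) (Ioo 0 1) y := by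
    intro y hy
    have h1 : HasDerivAt (fun y : ℝ => 1 - y ^ 2) (-(2 * y)) y := by
      simpa using (hasDerivAt_pow 2 y).const_sub (1 : ℝ)
    exact (h1.sqrt (hpos y hy).ne').hasDerivWithinAt
  have hinj : InjOn (fun y : ℝ => √(1 - y ^ 2)) (Ioo 0 1) := by
    intro y₁ h₁ y₂ h₂ h
    have h' : 1 - y₁ ^ 2 = 1 - y₂ ^ 2 := (Real.sqrt_inj (hpos y₁ h₁).le (hpos y₂ h₂).le).1 h
    exact (pow_left_inj₀ h₁.1.le h₂.1.le two_ne_zero).1 (by linarith)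
  have himage : (fun y : ℝ => √(1 - y ^ 2)) '' Ioo 0 1 = Ioo 0 1 := by
    ext x
    constructor
    · rintro ⟨y, hy, rfl⟩
      refine ⟨Real.sqrt_pos.2 (hpos y hy), ?_⟩
      rw [Real.sqrt_lt' one_pos, one_pow]
      nlinarith [hy.1]
    · intro hx
      have hx2 : 0 < 1 - x ^ 2 := by nlinarith [hx.1, hx.2]
      refine ⟨√(1 - x ^ 2), ⟨Real.sqrt_pos.2 hx2, ?_⟩, ?_⟩
      · rw [Real.sqrt_lt' one_pos, one_pow]
        nlinarith [hx.1]
      · dsimp only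
        rw [Real.sq_sqrt hx2.le, sub_sub_cancel, Real.sqrt_sq hx.1.le]
  have key := lintegral_image_eq_lintegral_abs_deriv_mul measurableSet_Ioo hderiv hinj g
  rw [himage] at key; rw [key]
  refine setLIntegral_congr_fun measurableSet_Ioo fun y hy => ?_
  rw [neg_div, mul_div_mul_left _ _ (two_ne_zero' ℝ), abs_neg,
    abs_of_pos (div_pos hy.1 (Real.sqrt_pos.2 (hpos y hy)))]

/-- **The duality core of the angular contraction lemma** (any finite measure space): if `u` is
measurable with `|u| ≤ m` and annihilates the constants and a "height" `φ` (`∫ u = 0`,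
`∫ φ u = 0`), then for every profile `k` with `k ∘ φ` integrable and every affine `A + B x`,
`|∫ k(φ) u| ≤ m ∫ |k(φ) - A - B φ|` (subtract `A + B φ`, which `u` kills). [folklore] -/
theorem abs_integral_mul_le_of_orthogonal {α : Type*} [MeasurableSpace α] {μ : Measure α}
    [IsFiniteMeasure μ] {φ u : α → ℝ} {k : ℝ → ℝ} {m : ℝ} (A B : ℝ) (hφ : Integrable φ μ)
    (hk : Integrable (fun ω => k (φ ω)) μ) (hu : AEStronglyMeasurable u μ) (hm : ∀ ω, |u ω| ≤ m)
    (h0 : ∫ ω, u ω ∂μ = 0) (h1 : ∫ ω, φ ω * u ω ∂μ = 0) :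
    |∫ ω, k (φ ω) * u ω ∂μ| ≤ m * ∫ ω, |k (φ ω) - A - B * φ ω| ∂μ := by
  have hbd : ∀ᵐ ω ∂μ, ‖u ω‖ ≤ m :=
    Eventually.of_forall fun ω => by rw [Real.norm_eq_abs]; exact hm ω
  have huI : Integrable u μ := (integrable_const m).mono' hu hbd
  have hdS : Integrable (fun ω => k (φ ω) - A - B * φ ω) μ :=
    (hk.sub (integrable_const A)).sub (hφ.const_mul B)
  have hI1 : Integrable (fun ω => (k (φ ω) - A - B * φ ω) * u ω) μ := hdS.mul_bdd hu hbd
  have hI2 : Integrable (fun ω => A * u ω) μ := huI.const_mul A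
  have hI3 : Integrable (fun ω => B * (φ ω * u ω)) μ := (hφ.mul_bdd hu hbd).const_mul B
  have hI12 : Integrable (fun ω => (k (φ ω) - A - B * φ ω) * u ω + A * u ω) μ := hI1.add hI2
  have hint : ∫ ω, k (φ ω) * u ω ∂μ = ∫ ω, (k (φ ω) - A - B * φ ω) * u ω ∂μ := by
    have hsplit : ∀ ω, k (φ ω) * u ω =
        (k (φ ω) - A - B * φ ω) * u ω + A * u ω + B * (φ ω * u ω) := fun ω => by ring
    simp_rw [hsplit]
    rw [integral_add hI12 hI3, integral_add hI1 hI2, integral_const_mul, integral_const_mul, h0, h1,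
      mul_zero, mul_zero, add_zero, add_zero]
  rw [hint]
  calc |∫ ω, (k (φ ω) - A - B * φ ω) * u ω ∂μ|
      ≤ ∫ ω, |(k (φ ω) - A - B * φ ω) * u ω| ∂μ := abs_integral_le_integral_abs
    _ ≤ ∫ ω, m * |k (φ ω) - A - B * φ ω| ∂μ := by
        refine integral_mono hI1.abs (hdS.abs.const_mul m) fun ω => ?_
        dsimp only
        rw [abs_mul, mul_comm]
        exact mul_le_mul_of_nonneg_right (hm ω) (abs_nonneg _)
    _ = m * ∫ ω, |k (φ ω) - A - B * φ ω| ∂μ := integral_const_mul _ _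

/-! ### The hat-box law -/

/-- The equator of a nonzero vector is `σ`-null: `σ{ν ∈ S² | ⟪a, ν⟫ = 0} = 0` (the cone over it
lies in the proper subspace `a^⊥`, which is Lebesgue-null). [folklore] -/
theorem sphereMeasure_inner_eq_zero {a : EuclideanSpace ℝ (Fin 3)} (ha : a ≠ 0) :
    sphereMeasure {ν : sphere (0 : EuclideanSpace ℝ (Fin 3)) 1 | ⟪a, ν⟫_ℝ = 0} = 0 := by
  -- adapted from `LorentzGasGenericity.sphereMeasure_setOf_mem_submodule`
  set K : Submodule ℝ (EuclideanSpace ℝ (Fin 3)) := (ℝ ∙ a)ᗮ with hK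
  have hKtop : K ≠ ⊤ := by
    intro htop
    have hmem : a ∈ K := htop ▸ Submodule.mem_top
    exact ha (inner_self_eq_zero.1 (Submodule.mem_orthogonal_singleton_iff_inner_right.1 hmem))
  set S : Set (sphere (0 : EuclideanSpace ℝ (Fin 3)) 1) := {ν | ⟪a, ν⟫_ℝ = 0} with hS
  have hset :
      S = {ν : sphere (0 : EuclideanSpace ℝ (Fin 3)) 1 | (ν : EuclideanSpace ℝ (Fin 3)) ∈ K} := by
    ext ν
    simp [hS, hK, Submodule.mem_orthogonal_singleton_iff_inner_right]
  have hs : MeasurableSet S :=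
    hset ▸ measurable_subtype_coe K.closed_of_finiteDimensional.measurableSet
  have hsub : Ioo (0 : ℝ) 1 • (Subtype.val '' S) ⊆ (K : Set (EuclideanSpace ℝ (Fin 3))) := by
    intro y hy
    obtain ⟨r, -, w, ⟨ω, hω, rfl⟩, rfl⟩ := Set.mem_smul.1 hy
    exact K.smul_mem r (hset.le hω)
  unfold sphereMeasure
  rw [Measure.toSphere_apply' _ hs,
    measure_mono_null hsub (Measure.addHaar_submodule volume K hKtop), mul_zero]

/-- **Archimedes' hat-box theorem on the open upper hemisphere** (lower-integral form): for a unit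
vector `a` of `ℝ³` and measurable `g ≥ 0` on `ℝ`,
`∫_{⟪a,ν⟫ > 0} g(⟪a, ν⟫) dσ(ν) = 2π ∫₀¹ g(x) dx` — the height `⟪a, ν⟫` of a uniform point of the
hemisphere is uniform. Proof: the flux form of the hat-box theorem
(`lintegral_toSphere_cos_comp_coords`: under `⟪a, ν⟫₊ dσ` the tangential coordinates are Lebesgue
on the unit disc) tested against `g(√(1 - |p|²)) / √(1 - |p|²)`, polar coordinates in the disc,
and the substitution `x = √(1 - y²)`. [folklore] -/
theorem lintegral_sphere_indicator_Ioi_comp_inner {a : EuclideanSpace ℝ (Fin 3)} (ha : ‖a‖ = 1)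
    {g : ℝ → ℝ≥0∞} (hg : Measurable g) :
    ∫⁻ ν : sphere (0 : EuclideanSpace ℝ (Fin 3)) 1, (Ioi (0 : ℝ)).indicator g ⟪a, ν⟫_ℝ
      ∂sphereMeasure = ENNReal.ofReal (2 * π) * ∫⁻ x in Ioo (0 : ℝ) 1, g x := by
  -- the test function `G(√(1 - r²))`, `G c = g c / c`
  have hGm : Measurable fun c : ℝ => g c * (ENNReal.ofReal c)⁻¹ :=
    hg.mul ENNReal.measurable_ofReal.inv
  have hRm : Measurable fun r : ℝ => g (√(1 - r ^ 2)) * (ENNReal.ofReal (√(1 - r ^ 2)))⁻¹ :=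
    hGm.comp (measurable_const.sub (measurable_id.pow_const 2)).sqrt
  have hFm : Measurable fun p : EuclideanSpace ℝ (Fin 2) =>
      g (√(1 - ‖p‖ ^ 2)) * (ENNReal.ofReal (√(1 - ‖p‖ ^ 2)))⁻¹ := hRm.comp measurable_norm
  have key := lintegral_toSphere_cos_comp_coords ha hFm
  -- on the sphere the tested flux integrand is `1_{⟪a,ν⟫ > 0} g(⟪a,ν⟫)`
  have hL : ∀ ν : sphere (0 : EuclideanSpace ℝ (Fin 3)) 1, ENNReal.ofReal ⟪a, ν⟫_ℝ *
      (g (√(1 - ‖Lambert.coords a ν‖ ^ 2)) * (ENNReal.ofReal (√(1 - ‖Lambert.coords a ν‖ ^ 2)))⁻¹) =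
      (Ioi (0 : ℝ)).indicator g ⟪a, ν⟫_ℝ := by
    intro ν
    have hν : ‖(ν : EuclideanSpace ℝ (Fin 3))‖ = 1 := by simp
    rcases le_or_gt ⟪a, ν⟫_ℝ 0 with hle | hpos
    · rw [ENNReal.ofReal_eq_zero.2 hle, zero_mul,
        indicator_of_notMem (fun h : ⟪a, ν⟫_ℝ ∈ Ioi (0 : ℝ) => (not_lt.2 hle) (mem_Ioi.1 h))]
    · rw [Lambert.sqrt_one_sub_norm_sq_coords ha hν hpos.le, indicator_of_mem (mem_Ioi.2 hpos),
        mul_left_comm,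
        ENNReal.mul_inv_cancel (ENNReal.ofReal_pos.2 hpos).ne' ENNReal.ofReal_ne_top, mul_one]
  simp_rw [hL] at key
  unfold sphereMeasure
  rw [key]
  -- the disc integral in polar coordinates
  have h1 : ∫⁻ p in ball (0 : EuclideanSpace ℝ (Fin 2)) 1,
        g (√(1 - ‖p‖ ^ 2)) * (ENNReal.ofReal (√(1 - ‖p‖ ^ 2)))⁻¹ =
      ∫⁻ p : EuclideanSpace ℝ (Fin 2), (Iio (1 : ℝ)).indicator
        (fun r => g (√(1 - r ^ 2)) * (ENNReal.ofReal (√(1 - r ^ 2)))⁻¹) ‖p‖ := by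
    rw [← lintegral_indicator measurableSet_ball]
    congr 1 with p
    by_cases hp : ‖p‖ < 1
    · rw [indicator_of_mem (mem_ball_zero_iff.2 hp), indicator_of_mem (mem_Iio.2 hp)]
    · rw [indicator_of_notMem (fun h => hp (mem_ball_zero_iff.1 h)),
        indicator_of_notMem (fun h => hp (mem_Iio.1 h))]
  rw [h1, Literature.Probability.Distributions.lintegral_fun_norm_addHaar volume _
    (hRm.indicator measurableSet_Iio), finrank_euclideanSpace_fin,
    EuclideanSpace.volume_ball_fin_two, ENNReal.ofReal_one, one_pow, one_mul]
  have h2 : ∫⁻ y in Ioi (0 : ℝ), ENNReal.ofReal (y ^ (2 - 1)) * (Iio (1 : ℝ)).indicator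
        (fun r => g (√(1 - r ^ 2)) * (ENNReal.ofReal (√(1 - r ^ 2)))⁻¹) y =
      ∫⁻ y in Ioo (0 : ℝ) 1, ENNReal.ofReal (y / √(1 - y ^ 2)) * g (√(1 - y ^ 2)) := by
    have h3 : ∀ y : ℝ, ENNReal.ofReal (y ^ (2 - 1)) * (Iio (1 : ℝ)).indicator
        (fun r => g (√(1 - r ^ 2)) * (ENNReal.ofReal (√(1 - r ^ 2)))⁻¹) y =
        (Iio (1 : ℝ)).indicator (fun r =>
          ENNReal.ofReal r * (g (√(1 - r ^ 2)) * (ENNReal.ofReal (√(1 - r ^ 2)))⁻¹)) y := by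
      intro y
      by_cases hy : y ∈ Iio (1 : ℝ)
      · rw [indicator_of_mem hy, indicator_of_mem hy, pow_one]
      · rw [indicator_of_notMem hy, indicator_of_notMem hy, mul_zero]
    simp_rw [h3]
    rw [lintegral_indicator measurableSet_Iio, Measure.restrict_restrict measurableSet_Iio,
      inter_comm, Ioi_inter_Iio]
    refine setLIntegral_congr_fun measurableSet_Ioo fun y hy => ?_
    have hs : 0 < √(1 - y ^ 2) := Real.sqrt_pos.2 (by nlinarith [hy.1, hy.2])
    rw [ENNReal.ofReal_div_of_pos hs, div_eq_mul_inv]; ring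
  rw [h2, lintegral_Ioo_comp_sqrt_one_sub_sq g, ENNReal.ofReal_mul zero_le_two,
    ENNReal.ofReal_ofNat]; push_cast; ring

/-- The height function `ν ↦ ⟪a, ν⟫` on the sphere is measurable. [folklore] -/
theorem measurable_sphere_inner (a : EuclideanSpace ℝ (Fin 3)) :
    Measurable fun ν : sphere (0 : EuclideanSpace ℝ (Fin 3)) 1 => ⟪a, ν⟫_ℝ :=
  (continuous_const.inner continuous_subtype_val).measurable

/-- **Archimedes' hat-box theorem** (lower-integral form): for a unit vector `a` of `ℝ³` and
measurable `g ≥ 0`, `∫_{S²} g(⟪a, ν⟫) dσ(ν) = 2π ∫_{-1}^{1} g(x) dx` — the height of a uniform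
point of the sphere is uniformly distributed (upper hemisphere, lower hemisphere via `a ↦ -a`,
`g ↦ g(-·)`, and the null equator). [folklore] -/
theorem lintegral_sphere_comp_inner {a : EuclideanSpace ℝ (Fin 3)} (ha : ‖a‖ = 1) {g : ℝ → ℝ≥0∞}
    (hg : Measurable g) :
    ∫⁻ ν : sphere (0 : EuclideanSpace ℝ (Fin 3)) 1, g ⟪a, ν⟫_ℝ ∂sphereMeasure =
      ENNReal.ofReal (2 * π) * ∫⁻ x in Icc (-1 : ℝ) 1, g x := by
  have ha0 : a ≠ 0 := fun h => by rw [h, norm_zero] at ha; exact zero_ne_one ha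
  have hφ := measurable_sphere_inner a
  -- the three pieces of `g`
  set g₁ : ℝ → ℝ≥0∞ := (Ioi (0 : ℝ)).indicator g with hg₁
  set g₂ : ℝ → ℝ≥0∞ := (Ioi (0 : ℝ)).indicator fun x => g (-x) with hg₂
  set g₃ : ℝ → ℝ≥0∞ := ({0} : Set ℝ).indicator g with hg₃
  have hsplit : ∀ c : ℝ, g c = g₁ c + g₂ (-c) + g₃ c := by
    intro c
    simp only [hg₁, hg₂, hg₃]
    rcases lt_trichotomy c 0 with hc | rfl | hc
    · rw [indicator_of_notMem (fun h : c ∈ Ioi (0 : ℝ) => (not_lt.2 hc.le) (mem_Ioi.1 h)),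
        indicator_of_mem (mem_Ioi.2 (neg_pos.2 hc)), neg_neg,
        indicator_of_notMem (fun h : c ∈ ({0} : Set ℝ) => hc.ne (mem_singleton_iff.1 h))]
      simp
    · simp
    · rw [indicator_of_mem (mem_Ioi.2 hc), indicator_of_notMem
          (fun h : -c ∈ Ioi (0 : ℝ) => (not_lt.2 (neg_nonpos.2 hc.le)) (mem_Ioi.1 h)),
        indicator_of_notMem (fun h : c ∈ ({0} : Set ℝ) => hc.ne' (mem_singleton_iff.1 h))]
      simp
  have hm1 : Measurable fun ν : sphere (0 : EuclideanSpace ℝ (Fin 3)) 1 => g₁ ⟪a, ν⟫_ℝ :=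
    (hg.indicator measurableSet_Ioi).comp hφ
  have hm3 : Measurable fun ν : sphere (0 : EuclideanSpace ℝ (Fin 3)) 1 => g₃ ⟪a, ν⟫_ℝ :=
    (hg.indicator (measurableSet_singleton 0)).comp hφ
  -- the equator contributes nothing
  have hzero : ∫⁻ ν : sphere (0 : EuclideanSpace ℝ (Fin 3)) 1, g₃ ⟪a, ν⟫_ℝ ∂sphereMeasure = 0 := by
    have h0 : (fun ν : sphere (0 : EuclideanSpace ℝ (Fin 3)) 1 => g₃ ⟪a, ν⟫_ℝ) =
        {ν : sphere (0 : EuclideanSpace ℝ (Fin 3)) 1 | ⟪a, ν⟫_ℝ = 0}.indicator fun _ => g 0 := by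
      funext ν
      simp only [hg₃]
      by_cases h : ⟪a, ν⟫_ℝ = 0
      · rw [indicator_of_mem (mem_singleton_iff.2 h), h, indicator_of_mem (by simpa using h)]
      · rw [indicator_of_notMem (fun h' => h (mem_singleton_iff.1 h')),
          indicator_of_notMem (by simpa using h)]
    have hs0 : MeasurableSet {ν : sphere (0 : EuclideanSpace ℝ (Fin 3)) 1 | ⟪a, ν⟫_ℝ = 0} :=
      hφ (measurableSet_singleton 0)
    rw [h0, lintegral_indicator hs0, setLIntegral_const, sphereMeasure_inner_eq_zero ha0, mul_zero]
  -- the lower hemisphere is the upper hemisphere of `-a`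
  have hneg : ∫⁻ x in Ioo (0 : ℝ) 1, g (-x) = ∫⁻ x in Ioo (-1 : ℝ) 0, g x := by
    have himage : Ioo (-1 : ℝ) 0 = Neg.neg '' Ioo (0 : ℝ) 1 := by
      rw [Set.image_neg_Ioo, neg_zero]
    rw [himage, lintegral_image_eq_lintegral_abs_deriv_mul measurableSet_Ioo
      (fun x _ => (hasDerivWithinAt_neg x (Ioo (0 : ℝ) 1))) (fun x _ y _ h => neg_injective h) g]
    exact setLIntegral_congr_fun measurableSet_Ioo fun y _ => by simp
  calc ∫⁻ ν : sphere (0 : EuclideanSpace ℝ (Fin 3)) 1, g ⟪a, ν⟫_ℝ ∂sphereMeasure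
      = ∫⁻ ν : sphere (0 : EuclideanSpace ℝ (Fin 3)) 1,
          g₁ ⟪a, ν⟫_ℝ + g₂ ⟪-a, ν⟫_ℝ + g₃ ⟪a, ν⟫_ℝ ∂sphereMeasure := by
        refine lintegral_congr fun ν => ?_
        rw [inner_neg_left]
        exact hsplit _
    _ = (∫⁻ ν : sphere (0 : EuclideanSpace ℝ (Fin 3)) 1, g₁ ⟪a, ν⟫_ℝ ∂sphereMeasure) +
          (∫⁻ ν : sphere (0 : EuclideanSpace ℝ (Fin 3)) 1, g₂ ⟪-a, ν⟫_ℝ ∂sphereMeasure) +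
          ∫⁻ ν : sphere (0 : EuclideanSpace ℝ (Fin 3)) 1, g₃ ⟪a, ν⟫_ℝ ∂sphereMeasure := by
        rw [lintegral_add_right _ hm3, lintegral_add_left hm1]
    _ = ENNReal.ofReal (2 * π) * (∫⁻ x in Ioo (0 : ℝ) 1, g x) +
          ENNReal.ofReal (2 * π) * (∫⁻ x in Ioo (-1 : ℝ) 0, g x) := by
        rw [hzero, add_zero, hg₁, hg₂, lintegral_sphere_indicator_Ioi_comp_inner ha hg,
          lintegral_sphere_indicator_Ioi_comp_inner (g := fun x => g (-x)) (by rwa [norm_neg])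
            (hg.comp measurable_neg), hneg]
    _ = ENNReal.ofReal (2 * π) * ∫⁻ x in Icc (-1 : ℝ) 1, g x := by
        rw [← mul_add, add_comm, setLIntegral_congr (Ioo_ae_eq_Icc (μ := (volume : Measure ℝ))),
          setLIntegral_congr (Ioo_ae_eq_Ioc (μ := (volume : Measure ℝ))),
          ← lintegral_union measurableSet_Ioc
            (Set.disjoint_left.2 fun x hx hx' => (not_lt.2 hx.2) hx'.1),
          Icc_union_Ioc_eq_Icc (by norm_num) (by norm_num)]

/-- **Registered helper `t12_sphereMeasure_map_inner` — Archimedes' hat-box theorem as an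
identity of measures**: for a unit vector `a` of `ℝ³`, the image of the surface measure `σ` of
`S²` under the height `ν ↦ ⟪a, ν⟫` is `2π` times Lebesgue measure on `[-1, 1]`. This is the law
that turns every zonal integral `∫_{S²} k(⟪n, ω⟫) (…) dσ(ω)` of the far-field calculus of the
corrector analysis (`t12_logLinearPreimage_and_dipoleModulus`, plan §2, §6) into a one-dimensional
integral `2π ∫_{-1}^{1} k(x) (…) dx`. [folklore] -/
theorem t12_sphereMeasure_map_inner : ∀ a : EuclideanSpace ℝ (Fin 3), ‖a‖ = 1 → MeasureTheory.Measure.map (fun ω : Metric.sphere (0 : EuclideanSpace ℝ (Fin 3)) 1 => inner ℝ a (ω : EuclideanSpace ℝ (Fin 3))) Literature.MathematicalPhysics.KineticTheory.sphereMeasure = ENNReal.ofReal (2 * Real.pi) • MeasureTheory.volume.restrict (Set.Icc (-1 : ℝ) 1) := by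
  intro a ha
  have hφ := measurable_sphere_inner a
  ext s hs
  rw [Measure.map_apply hφ hs, Measure.smul_apply, Measure.restrict_apply hs, smul_eq_mul,
    ← lintegral_indicator_one (hφ hs)]
  have h1 : ∀ ν : sphere (0 : EuclideanSpace ℝ (Fin 3)) 1,
      ((fun ω : sphere (0 : EuclideanSpace ℝ (Fin 3)) 1 => ⟪a, ω⟫_ℝ) ⁻¹' s).indicator 1 ν =
        s.indicator (1 : ℝ → ℝ≥0∞) ⟪a, ν⟫_ℝ := fun ν =>
    indicator_comp_right (fun ω : sphere (0 : EuclideanSpace ℝ (Fin 3)) 1 => ⟪a, ω⟫_ℝ)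
      (g := (1 : ℝ → ℝ≥0∞))
  simp_rw [h1]
  rw [lintegral_sphere_comp_inner ha (measurable_one.indicator hs), lintegral_indicator_one hs,
    Measure.restrict_apply hs]

/-- Integrability transfer: `ν ↦ g(⟪a, ν⟫)` is `σ`-integrable on `S²` iff `g` is integrable on
`[-1, 1]` (for `g` a.e.-strongly measurable on `[-1, 1]`; unit `a`). [folklore] -/
theorem integrable_sphere_comp_inner_iff {a : EuclideanSpace ℝ (Fin 3)} (ha : ‖a‖ = 1)
    {G : Type*} [NormedAddCommGroup G] {g : ℝ → G}
    (hg : AEStronglyMeasurable g (volume.restrict (Icc (-1 : ℝ) 1))) :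
    Integrable (fun ν : sphere (0 : EuclideanSpace ℝ (Fin 3)) 1 => g ⟪a, ν⟫_ℝ) sphereMeasure ↔
      IntegrableOn g (Icc (-1 : ℝ) 1) := by
  have hmap := t12_sphereMeasure_map_inner a ha
  have h2π : ENNReal.ofReal (2 * π) ≠ 0 := (ENNReal.ofReal_pos.2 (by positivity)).ne'
  have hg' := hg.smul_measure (ENNReal.ofReal (2 * π))
  rw [← hmap] at hg'
  have key := integrable_map_measure hg' (measurable_sphere_inner a).aemeasurable
  rw [hmap, integrable_smul_measure h2π ENNReal.ofReal_ne_top] at key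
  exact key.symm

/-- **Archimedes' hat-box theorem, Bochner form**: `∫_{S²} g(⟪a, ν⟫) dσ(ν) = 2π ∫_{-1}^{1} g(x) dx`
for every `g` a.e.-strongly measurable on `[-1, 1]` with values in a Banach space (unit `a`; both
sides vanish together when `g` is not integrable). [folklore] -/
theorem integral_sphere_comp_inner {a : EuclideanSpace ℝ (Fin 3)} (ha : ‖a‖ = 1) {G : Type*}
    [NormedAddCommGroup G] [NormedSpace ℝ G] {g : ℝ → G}
    (hg : AEStronglyMeasurable g (volume.restrict (Icc (-1 : ℝ) 1))) :
    ∫ ν : sphere (0 : EuclideanSpace ℝ (Fin 3)) 1, g ⟪a, ν⟫_ℝ ∂sphereMeasure =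
      (2 * π) • ∫ x in (-1 : ℝ)..1, g x := by
  have hmap := t12_sphereMeasure_map_inner a ha
  have hg' := hg.smul_measure (ENNReal.ofReal (2 * π))
  rw [← hmap] at hg'
  rw [← integral_map (measurable_sphere_inner a).aemeasurable hg', hmap, integral_smul_measure,
    ENNReal.toReal_ofReal (by positivity), intervalIntegral.integral_of_le (by norm_num),
    integral_Icc_eq_integral_Ioc]

/-- Real-valued hat-box theorem: `∫_{S²} g(⟪a, ν⟫) dσ(ν) = 2π ∫_{-1}^{1} g` (unit `a`). [folklore] -/
theorem integral_sphere_comp_inner_real {a : EuclideanSpace ℝ (Fin 3)} (ha : ‖a‖ = 1) {g : ℝ → ℝ}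
    (hg : AEStronglyMeasurable g (volume.restrict (Icc (-1 : ℝ) 1))) :
    ∫ ν : sphere (0 : EuclideanSpace ℝ (Fin 3)) 1, g ⟪a, ν⟫_ℝ ∂sphereMeasure =
      2 * π * ∫ x in (-1 : ℝ)..1, g x := by
  rw [integral_sphere_comp_inner ha hg, smul_eq_mul]

/-- Zonal functions of the height are integrable on the sphere as soon as the profile is
integrable on `[-1, 1]`, e.g. `IntervalIntegrable k volume (-1) 1`. [folklore] -/
theorem integrable_sphere_comp_inner_of_intervalIntegrable {a : EuclideanSpace ℝ (Fin 3)}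
    (ha : ‖a‖ = 1) {k : ℝ → ℝ} (hk : IntervalIntegrable k volume (-1) 1) :
    Integrable (fun ν : sphere (0 : EuclideanSpace ℝ (Fin 3)) 1 => k ⟪a, ν⟫_ℝ) sphereMeasure := by
  have hkI : IntegrableOn k (Icc (-1 : ℝ) 1) :=
    (intervalIntegrable_iff_integrableOn_Icc_of_le (by norm_num)).1 hk
  exact (integrable_sphere_comp_inner_iff ha hkI.aestronglyMeasurable).2 hkI

/-! ### FF3: the angular contraction (duality) lemma -/

/-- **Registered helper `t12_angularContraction` (FF3 of the plan, §6): the angular contraction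
lemma.** Let `k` be a zonal kernel profile, integrable on `[-1, 1]`, acting on `S²` through
`(K u)(a) = ∫_{S²} k(⟪a, ω⟫) u(ω) dσ(ω)`, and let `u` be bounded, `|u| ≤ m`, measurable, with ZERO
ZONAL AVERAGE `∫ u dσ = 0` and ZERO DIPOLE MOMENT `∫ u(ω) ω dσ(ω) = 0` (no `ℓ = 0, 1` components).
Then for every affine profile `A + B x`,
`|(K u)(a)| ≤ m · ∫_{S²} |k(⟪a, ω⟫) - A - B⟪a, ω⟫| dσ(ω) = m · 2π ∫_{-1}^{1} |k(x) - A - B x| dx`: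
subtract `A + B⟪a, ω⟫`, which `u` annihilates (`abs_integral_mul_le_of_orthogonal`), and apply the
hat-box theorem. Optimising over `A, B` gives the `L¹[-1,1]`-distance of `k` to `span{1, x}` — the
trivial direction of the `L^∞ → L^∞` duality for zonal operators on the sector `ℓ ≥ 2`; with
`k = (2/π) x₊²` (one far-field collision step) the constant is `4 · (1/4) = 1`. [folklore] -/
theorem t12_angularContraction : ∀ a : EuclideanSpace ℝ (Fin 3), ‖a‖ = 1 → ∀ (k : ℝ → ℝ) (A B : ℝ), IntervalIntegrable k MeasureTheory.volume (-1) 1 → ∀ (u : Metric.sphere (0 : EuclideanSpace ℝ (Fin 3)) 1 → ℝ) (m : ℝ), MeasureTheory.AEStronglyMeasurable u Literature.MathematicalPhysics.KineticTheory.sphereMeasure → (∀ ω, |u ω| ≤ m) → ∫ ω, u ω ∂Literature.MathematicalPhysics.KineticTheory.sphereMeasure = 0 → ∫ ω, u ω • (ω : EuclideanSpace ℝ (Fin 3)) ∂Literature.MathematicalPhysics.KineticTheory.sphereMeasure = 0 → |∫ ω, k (inner ℝ a (ω : EuclideanSpace ℝ (Fin 3))) * u ω ∂Literature.MathematicalPhysics.KineticTheory.sphereMeasure|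 ≤ m * (2 * Real.pi * ∫ x in (-1 : ℝ)..1, |k x - A - B * x|) := by
  intro a ha k A B hk u m hu hm h0 h1
  haveI := isFiniteMeasure_sphereMeasure (E := EuclideanSpace ℝ (Fin 3))
  have hxI : Integrable (fun ω : sphere (0 : EuclideanSpace ℝ (Fin 3)) 1 => ⟪a, ω⟫_ℝ)
      sphereMeasure := integrable_sphere_of_continuous' (by fun_prop)
  -- the zero dipole moment kills the linear profile
  have hdip : ∫ ω : sphere (0 : EuclideanSpace ℝ (Fin 3)) 1, ⟪a, ω⟫_ℝ * u ω ∂sphereMeasure = 0 := by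
    have huI : Integrable u sphereMeasure := (integrable_const m).mono' hu
      (Eventually.of_forall fun ω => by rw [Real.norm_eq_abs]; exact hm ω)
    have h := integral_inner (𝕜 := ℝ) (integrable_smul_sphere huI) a
    simp_rw [inner_smul_right] at h
    rw [h1, inner_zero_right] at h
    simpa [mul_comm] using h
  have habs : AEStronglyMeasurable (fun x : ℝ => |k x - A - B * x|)
      (volume.restrict (Icc (-1 : ℝ) 1)) := by
    have hkI : IntegrableOn k (Icc (-1 : ℝ) 1) :=
      (intervalIntegrable_iff_integrableOn_Icc_of_le (by norm_num)).1 hk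
    exact continuous_abs.comp_aestronglyMeasurable
      ((hkI.aestronglyMeasurable.sub aestronglyMeasurable_const).sub
        (continuous_const.mul continuous_id).aestronglyMeasurable)
  have key := abs_integral_mul_le_of_orthogonal A B hxI
    (integrable_sphere_comp_inner_of_intervalIntegrable ha hk) hu hm h0 hdip
  rwa [integral_sphere_comp_inner_real ha habs] at key

end Summit.AtomisticToContinuum.HydrodynamicLimit.Theorems.ClampedCorrectorBirth
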